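import Literature.MeasureTheory.Group.InvariantQuotientCompactOpenMass
import Mathlib.GroupTheory.DoubleCoset
import HarnessLib

/-!
# Unfolding an invariant measure on `G ⧸ H` over the double cosets `K \ G / H` of an open subgroup:
`∫_{G ⧸ H} F dμ = Σ_{q ∈ K\G/H} F(x_q H) · μ(K x_q H / H)` and the orbit masses
`(ν/ρ)(K x H / H) = ν(K) / ρ(H ∩ x⁻¹ K x)`
(Laumon, *Cohomology of Drinfeld modular varieties* I (1996), Lemma (5.3.2) (orbital integrals as
weighted counts of fixed facets); Deitmar–Echterhoff, *Principles of Harmonic Analysis* (2014),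
Thm. 1.5.3; Rogawski (1990), §4.9 p. 54)

Topic `MeasureTheory/Group`; namespace `Literature.MeasureTheory.Group`. THEOREMS ONLY (no
definition, no instance, no named fact, no `sorry`). Sequel of `InvariantQuotientCompactOpenMass`
(the mass `μ(π(K)) · ρ(H ∩ K) = c_μ · ν(K)` of the image of a compact open subgroup `K` in
`G ⧸ H`); here that mass formula is moved along the `K`-ORBITS of `G ⧸ H`, and an integral over
`G ⧸ H` of a `K`-invariant function is UNFOLDED into the sum of its values on the orbits.

Setting: `G` a topological group (second countable where countability of `K \ G / H` is needed),
`H K ≤ G` subgroups with `K` OPEN, `π : G → G ⧸ H` the quotient map, the Borel σ-algebra on `G ⧸ H`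
supplied as section hypotheses (as in the sibling files). The `K`-orbit of `π x` is
`K • π x = π(K x) = π(K x H)`, the image of the double coset `K x H` (Mathlib
`DoubleCoset.doubleCoset x K H = K * {x} * H`); the orbit space is Mathlib's double-coset quotient
`DoubleCoset.Quotient ↑K ↑H = K \ G / H`, and we write sums at the representatives `q.out`
(representative-independence lemmas are supplied, so consumers may re-index by their own
representatives).

* §1 `isOpen_doubleCoset`, `isOpen_image_mk_doubleCoset`, `countable_doubleCosetQuotient`
  (`K` open, `G` second countable: the double cosets are disjoint non-empty open sets),
  `pairwise_disjoint_image_mk_doubleCoset`, `iUnion_image_mk_doubleCoset` — **the `K`-orbits form a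
  countable partition of `G ⧸ H` into open sets**; `doubleCoset_out_mk_eq` (representatives).
* §2 **The orbit sum.** `lintegral_eq_tsum_doubleCoset`: for ANY measure `μ` on `G ⧸ H` and any
  `K`-invariant `F : G ⧸ H → [0, ∞]`,
  `∫⁻ F dμ = Σ'_{q : K\G/H} F(π q.out) · μ(π(K q.out H))` (no invariance of `μ`, no measurability
  hypothesis: `F` is constant on the sets of a countable measurable partition;
  `measurable_of_smul_invariant`); the Bochner twin `hasSum_integral_doubleCoset` /
  `integral_eq_tsum_doubleCoset` for integrable `K`-invariant `F : G ⧸ H → E`; finiteness of the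
  support from compact support (`finite_setOf_out_ne_zero_of_hasCompactSupport`) and the resulting
  `Finset` forms; an integrability criterion from finite support (`integrable_of_finite_support`).
* §3 **Orbit masses for a `G`-invariant `μ`.** `image_mk_doubleCoset_eq_smul_image`:
  `π(K x H) = x • π(x⁻¹ K x)` with `x⁻¹ K x = K.comap (MulAut.conj x)` (membership
  `g ∈ _ ↔ x g x⁻¹ ∈ K`, `mem_comap_conj_iff`); hence `μ(π(K x H)) = μ(π(x⁻¹ K x))`
  (`measure_image_mk_doubleCoset_eq`) and, by `InvariantQuotientCompactOpenMass`, for `K` compact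
  open, `H` closed, `ρ` a left Haar measure on `H`, `ν` a Haar measure on `G`:
  `μ(π(K x H)) = c_μ · ν(x⁻¹ K x) / ρ(H ∩ x⁻¹ K x)`
  (`measure_image_mk_doubleCoset_eq_unfoldingConstant_mul_div`) and for the quotient measure
  `ν/ρ = quotientMeasure H ρ ν` (two-sided `ν`): **`(ν/ρ)(π(K x H)) = ν(K) / ρ(H ∩ x⁻¹ K x)`**
  (`quotientMeasure_image_mk_doubleCoset_eq_div`); `0 < ρ(H ∩ x⁻¹ K x) < ∞`.
* §4 **The assembled unfolding**
  `∫⁻_{G ⧸ H} F d(ν/ρ) = Σ'_{q} F(π q.out) · ν(K) / ρ(H ∩ q.out⁻¹ K q.out)`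
  (`lintegral_quotientMeasure_eq_tsum_doubleCoset`; general `μ`:
  `lintegral_eq_tsum_doubleCoset_unfoldingConstant`).

With `H = C_G(γ)` a centraliser and `F(yH) = f(y γ y⁻¹)` the orbital integrand of a
`K`-conjugation-invariant `f` this is the classical expression of an orbital integral as a sum over
`K \ G / C_G(γ)` weighted by `vol(C_G(γ) ∩ x⁻¹ K x)⁻¹` — «the number of fixed points of `γ` on `G/K`,
counted modulo `C_G(γ)` with stabiliser weights» (Laumon (1996), Lemma (5.3.2); Kottwitz; Rogawski
§4.9); that dress is the sequel `NumberTheory/Automorphic/OrbitalIntegralDoubleCosetUnfolding`.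

## References

* G. Laumon, *Cohomology of Drinfeld Modular Varieties*, Part I, Cambridge Stud. Adv. Math. 41
  (1996), Lemma (5.3.2), p. 136 [Laumon1995].
* A. Deitmar, S. Echterhoff, *Principles of Harmonic Analysis*, 2nd ed. (2014), Thm. 1.5.3
  [DeitmarEchterhoff2014].
* J. D. Rogawski, *Automorphic Representations of Unitary Groups in Three Variables* (1990), §4.9
  p. 54 [Rogawski1990].
-/

noncomputable section

open _root_.MeasureTheory _root_.MeasureTheory.Measure _root_.Topology Set Filter Function
open scoped ENNReal NNReal Pointwise

/- The coset space carries the Borel σ-algebra supplied as a section hypothesis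
`[MeasurableSpace (G ⧸ H)] [BorelSpace (G ⧸ H)]` (a local instance, which takes precedence over
Mathlib's quotient σ-algebra `QuotientGroup.measurableSpace` during elaboration), as in
`InvariantQuotientNormalized`. -/

namespace Literature.MeasureTheory.Group

/-! ### §1 Double cosets of an open subgroup and the `K`-orbits of `G ⧸ H` -/

section DoubleCoset

variable {G : Type*} [Group G] (H K : Subgroup G)

/-- `π(K x H) = π(K x)`: the image in `G ⧸ H` of the double coset `K x H` is the image of the coset
`K x` (`π(k x h) = π(k x)`). [cite: Laumon1995, Lemma (5.3.2) p. 136] -/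
theorem image_mk_doubleCoset_eq_image_mul_singleton (x : G) :
    (QuotientGroup.mk : G → G ⧸ H) '' DoubleCoset.doubleCoset x (K : Set G) (H : Set G) =
      (QuotientGroup.mk : G → G ⧸ H) '' ((K : Set G) * {x}) := by
  ext y
  constructor
  · rintro ⟨g, hg, rfl⟩
    obtain ⟨a, ha, h, hh, rfl⟩ := Set.mem_mul.1 hg
    exact ⟨a, ha, (QuotientGroup.mk_mul_of_mem a hh).symm⟩
  · rintro ⟨a, ha, rfl⟩
    exact ⟨a, Set.mem_mul.2 ⟨a, ha, 1, H.one_mem, mul_one a⟩, rfl⟩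

/-- Membership in the image of a double coset: `y ∈ π(K x H) ↔ y = k • π x` for some `k ∈ K` — the
image of `K x H` in `G ⧸ H` is the `K`-orbit of `π x`. [cite: Laumon1995, Lemma (5.3.2) p. 136] -/
theorem mem_image_mk_doubleCoset_iff (x : G) (y : G ⧸ H) :
    y ∈ (QuotientGroup.mk : G → G ⧸ H) '' DoubleCoset.doubleCoset x (K : Set G) (H : Set G) ↔
      ∃ k ∈ K, y = k • (x : G ⧸ H) := by
  rw [image_mk_doubleCoset_eq_image_mul_singleton]
  constructor
  · rintro ⟨a, ha, rfl⟩
    obtain ⟨k, hk, z, hz, rfl⟩ := Set.mem_mul.1 ha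
    rw [Set.mem_singleton_iff] at hz
    subst hz
    exact ⟨k, hk, by rw [MulAction.Quotient.smul_coe, smul_eq_mul]⟩
  · rintro ⟨k, hk, rfl⟩
    exact ⟨k * x, Set.mem_mul.2 ⟨k, hk, x, Set.mem_singleton x, rfl⟩,
      by rw [MulAction.Quotient.smul_coe, smul_eq_mul]⟩

/-- A `K`-invariant function on `G ⧸ H` is constant on the image of each double coset `K x H`.
[cite: Laumon1995, Lemma (5.3.2) p. 136] -/
theorem apply_eq_apply_mk_of_mem_image_mk_doubleCoset {α : Type*} {F : G ⧸ H → α}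
    (hF : ∀ k : G, k ∈ K → ∀ y : G ⧸ H, F (k • y) = F y) {x : G} {y : G ⧸ H}
    (hy : y ∈ (QuotientGroup.mk : G → G ⧸ H) '' DoubleCoset.doubleCoset x (K : Set G) (H : Set G)) :
    F y = F (x : G ⧸ H) := by
  obtain ⟨k, hk, rfl⟩ := (mem_image_mk_doubleCoset_iff H K x y).1 hy
  exact hF k hk _

/-- The double coset of `x` is the double coset of the chosen representative of its class in
`K \ G / H`. [cite: Laumon1995, Lemma (5.3.2) p. 136] -/
theorem doubleCoset_out_mk_eq (x : G) :
    DoubleCoset.doubleCoset (DoubleCoset.mk K H x : DoubleCoset.Quotient (K : Set G) (H : Set G)).out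
        (K : Set G) (H : Set G) = DoubleCoset.doubleCoset x (K : Set G) (H : Set G) := by
  have hx : x ∈ DoubleCoset.quotToDoubleCoset K H
      (DoubleCoset.mk K H x : DoubleCoset.Quotient (K : Set G) (H : Set G)) :=
    (DoubleCoset.mem_quotToDoubleCoset_iff _ x).2 rfl
  exact (DoubleCoset.doubleCoset_eq_of_mem hx).symm

/-- If `mk K H x = q` then `π(K x H) = π(K q.out H)` (the summands of the orbit sums below do not
depend on the representative). [cite: Laumon1995, Lemma (5.3.2) p. 136] -/
theorem image_mk_doubleCoset_eq_of_mk_eq {x : G} {q : DoubleCoset.Quotient (K : Set G) (H : Set G)}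
    (hq : DoubleCoset.mk K H x = q) :
    (QuotientGroup.mk : G → G ⧸ H) '' DoubleCoset.doubleCoset x (K : Set G) (H : Set G) =
      (QuotientGroup.mk : G → G ⧸ H) '' DoubleCoset.doubleCoset q.out (K : Set G) (H : Set G) := by
  subst hq
  rw [doubleCoset_out_mk_eq]

/-- If `mk K H x = q` then a `K`-invariant `F` takes the same value at `π x` and `π q.out`.
[cite: Laumon1995, Lemma (5.3.2) p. 136] -/
theorem apply_mk_eq_apply_out_of_mk_eq {α : Type*} {F : G ⧸ H → α}
    (hF : ∀ k : G, k ∈ K → ∀ y : G ⧸ H, F (k • y) = F y) {x : G}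
    {q : DoubleCoset.Quotient (K : Set G) (H : Set G)} (hq : DoubleCoset.mk K H x = q) :
    F (x : G ⧸ H) = F (q.out : G ⧸ H) := by
  refine apply_eq_apply_mk_of_mem_image_mk_doubleCoset H K hF ?_
  rw [← image_mk_doubleCoset_eq_of_mk_eq H K hq]
  exact ⟨x, DoubleCoset.mem_doubleCoset_self K H x, rfl⟩

/-- **The images of the double cosets are pairwise disjoint**: `π(K a H) ∩ π(K b H) = ∅` for distinct
classes (a point of both lifts into `K a H ∩ K b H`). [cite: Laumon1995, Lemma (5.3.2) p. 136] -/
theorem pairwise_disjoint_image_mk_doubleCoset :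
    Pairwise (Disjoint on fun q : DoubleCoset.Quotient (K : Set G) (H : Set G) =>
      (QuotientGroup.mk : G → G ⧸ H) '' DoubleCoset.doubleCoset q.out (K : Set G) (H : Set G)) := by
  intro a b hab
  rw [Function.onFun, Set.disjoint_left]
  rintro y ⟨g, hg, rfl⟩ ⟨g', hg', hgg'⟩
  refine Set.disjoint_left.1 (DoubleCoset.disjoint_out hab) hg ?_
  -- `g = g' (g'⁻¹ g)` with `g'⁻¹ g ∈ H` and `g' ∈ K b.out H`
  have h1 : g'⁻¹ * g ∈ H := QuotientGroup.eq.1 hgg'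
  obtain ⟨k, hk, c, hc, hg'eq⟩ := DoubleCoset.mem_doubleCoset.1 hg'
  rw [DoubleCoset.mem_doubleCoset]
  refine ⟨k, hk, c * (g'⁻¹ * g), H.mul_mem hc h1, ?_⟩
  calc g = g' * (g'⁻¹ * g) := (mul_inv_cancel_left g' g).symm
    _ = k * b.out * c * (g'⁻¹ * g) := by rw [← hg'eq]
    _ = k * b.out * (c * (g'⁻¹ * g)) := by rw [mul_assoc]

/-- **The images of the double cosets cover `G ⧸ H`.** [cite: Laumon1995, Lemma (5.3.2) p. 136] -/
theorem iUnion_image_mk_doubleCoset :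
    ⋃ q : DoubleCoset.Quotient (K : Set G) (H : Set G),
      (QuotientGroup.mk : G → G ⧸ H) '' DoubleCoset.doubleCoset q.out (K : Set G) (H : Set G) =
        Set.univ := by
  rw [Set.eq_univ_iff_forall]
  intro y
  obtain ⟨g, rfl⟩ := QuotientGroup.mk_surjective y
  refine Set.mem_iUnion.2 ⟨DoubleCoset.mk K H g, g, ?_, rfl⟩
  rw [doubleCoset_out_mk_eq]
  exact DoubleCoset.mem_doubleCoset_self K H g

/-- Every point of `G ⧸ H` lies in the image of the double coset of (the representative of) its
class. [cite: Laumon1995, Lemma (5.3.2) p. 136] -/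
theorem mk_mem_image_mk_doubleCoset_out (g : G) :
    (g : G ⧸ H) ∈ (QuotientGroup.mk : G → G ⧸ H) ''
      DoubleCoset.doubleCoset (DoubleCoset.mk K H g : DoubleCoset.Quotient (K : Set G) (H : Set G)).out
        (K : Set G) (H : Set G) := by
  rw [doubleCoset_out_mk_eq]
  exact ⟨g, DoubleCoset.mem_doubleCoset_self K H g, rfl⟩

variable [TopologicalSpace G] [IsTopologicalGroup G]

/-- A double coset `K x H` of an OPEN subgroup `K` is open. [cite: Laumon1995, Lemma (5.3.2) p. 136] -/
theorem isOpen_doubleCoset (hK : IsOpen (K : Set G)) (x : G) :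
    IsOpen (DoubleCoset.doubleCoset x (K : Set G) (H : Set G)) := by
  unfold DoubleCoset.doubleCoset
  exact (hK.mul_right).mul_right

/-- The image `π(K x H)` in `G ⧸ H` of a double coset of an open subgroup `K` is open (the quotient
map is open). [cite: Laumon1995, Lemma (5.3.2) p. 136] -/
theorem isOpen_image_mk_doubleCoset (hK : IsOpen (K : Set G)) (x : G) :
    IsOpen ((QuotientGroup.mk : G → G ⧸ H) '' DoubleCoset.doubleCoset x (K : Set G) (H : Set G)) :=
  QuotientGroup.isOpenMap_coe _ (isOpen_doubleCoset H K hK x)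

/-- The image `π(K x H) = π(K x)` of a double coset of a COMPACT subgroup `K` is compact. [cite: Laumon1995, Lemma (5.3.2) p. 136] -/
theorem isCompact_image_mk_doubleCoset (hKc : IsCompact (K : Set G)) (x : G) :
    IsCompact ((QuotientGroup.mk : G → G ⧸ H) '' DoubleCoset.doubleCoset x (K : Set G) (H : Set G)) := by
  rw [image_mk_doubleCoset_eq_image_mul_singleton]
  exact (hKc.mul isCompact_singleton).image QuotientGroup.continuous_mk

/-- **`K \ G / H` is countable** for `K` open and `G` second countable: the double cosets are
pairwise disjoint non-empty open subsets of the separable space `G`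
(Mathlib `Pairwise.countable_of_isOpen_disjoint`). [cite: Laumon1995, Lemma (5.3.2) p. 136] -/
theorem countable_doubleCosetQuotient [SecondCountableTopology G] (hK : IsOpen (K : Set G)) :
    Countable (DoubleCoset.Quotient (K : Set G) (H : Set G)) :=
  Pairwise.countable_of_isOpen_disjoint
    (s := fun q : DoubleCoset.Quotient (K : Set G) (H : Set G) =>
      DoubleCoset.doubleCoset q.out (K : Set G) (H : Set G))
    (fun _ _ hab => DoubleCoset.disjoint_out hab) (fun _ => isOpen_doubleCoset H K hK _)
    fun q => ⟨q.out, DoubleCoset.mem_doubleCoset_self K H _⟩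

variable [MeasurableSpace (G ⧸ H)] [BorelSpace (G ⧸ H)]

/-- The image of a double coset of an open subgroup is a Borel set of `G ⧸ H`. [cite: DeitmarEchterhoff2014, Thm. 1.5.3] -/
theorem measurableSet_image_mk_doubleCoset (hK : IsOpen (K : Set G)) (x : G) :
    MeasurableSet ((QuotientGroup.mk : G → G ⧸ H) '' DoubleCoset.doubleCoset x (K : Set G) (H : Set G)) :=
  (isOpen_image_mk_doubleCoset H K hK x).measurableSet

/-- **A `K`-invariant function on `G ⧸ H` is Borel measurable** (`K` open, `G` second countable):
it is constant on the sets of the countable measurable partition by `K`-orbits. [cite: DeitmarEchterhoff2014, Thm. 1.5.3] -/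
theorem measurable_of_smul_invariant [SecondCountableTopology G] (hK : IsOpen (K : Set G))
    {α : Type*} [MeasurableSpace α] {F : G ⧸ H → α}
    (hF : ∀ k : G, k ∈ K → ∀ y : G ⧸ H, F (k • y) = F y) : Measurable F := by
  haveI := countable_doubleCosetQuotient H K hK
  intro s _
  have hpre : F ⁻¹' s = ⋃ q ∈ {q : DoubleCoset.Quotient (K : Set G) (H : Set G) | F (q.out : G ⧸ H) ∈ s},
      (QuotientGroup.mk : G → G ⧸ H) '' DoubleCoset.doubleCoset q.out (K : Set G) (H : Set G) := by
    ext y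
    simp only [Set.mem_preimage, Set.mem_iUnion, Set.mem_setOf_eq, exists_prop]
    constructor
    · intro hy
      obtain ⟨g, rfl⟩ := QuotientGroup.mk_surjective y
      refine ⟨DoubleCoset.mk K H g, ?_, mk_mem_image_mk_doubleCoset_out H K g⟩
      rwa [← apply_mk_eq_apply_out_of_mk_eq H K hF rfl]
    · rintro ⟨q, hq, hy⟩
      rwa [apply_eq_apply_mk_of_mem_image_mk_doubleCoset H K hF hy]
  rw [hpre]
  exact MeasurableSet.biUnion (Set.to_countable _) fun q _ => measurableSet_image_mk_doubleCoset H K hK _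

end DoubleCoset

/-! ### §2 The orbit sum: `∫_{G ⧸ H} F dμ = Σ_{K \ G / H} F(π q.out) · μ(π(K q.out H))` -/

section OrbitSum

variable {G : Type*} [Group G] [TopologicalSpace G] [IsTopologicalGroup G] [SecondCountableTopology G]
  (H K : Subgroup G) [MeasurableSpace (G ⧸ H)] [BorelSpace (G ⧸ H)]

/-- **The orbit sum (`[0, ∞]`-valued).** For an OPEN subgroup `K`, ANY measure `μ` on `G ⧸ H` and
any `K`-invariant `F : G ⧸ H → [0, ∞]`:
`∫⁻_{G ⧸ H} F dμ = Σ'_{q : K\G/H} F(π q.out) · μ(π(K q.out H))` — `G ⧸ H` is the countable disjoint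
union of the open orbits `π(K q.out H)` on each of which `F` is constant (Laumon (1996), proof of
Lemma (5.3.2): «our orbital integral is equal to `Σ_τ …`»). No invariance of `μ` and no measurability
of `F` is needed. [cite: Laumon1995, Lemma (5.3.2) p. 136] -/
theorem lintegral_eq_tsum_doubleCoset (hK : IsOpen (K : Set G)) (μ : Measure (G ⧸ H))
    {F : G ⧸ H → ℝ≥0∞} (hF : ∀ k : G, k ∈ K → ∀ y : G ⧸ H, F (k • y) = F y) :
    ∫⁻ y, F y ∂μ = ∑' q : DoubleCoset.Quotient (K : Set G) (H : Set G),
      F (q.out : G ⧸ H) *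
        μ ((QuotientGroup.mk : G → G ⧸ H) '' DoubleCoset.doubleCoset q.out (K : Set G) (H : Set G)) := by
  haveI := countable_doubleCosetQuotient H K hK
  have hm : ∀ q : DoubleCoset.Quotient (K : Set G) (H : Set G), MeasurableSet
      ((QuotientGroup.mk : G → G ⧸ H) '' DoubleCoset.doubleCoset q.out (K : Set G) (H : Set G)) :=
    fun q => measurableSet_image_mk_doubleCoset H K hK _
  rw [← setLIntegral_univ, ← iUnion_image_mk_doubleCoset H K,
    lintegral_iUnion hm (pairwise_disjoint_image_mk_doubleCoset H K)]
  refine tsum_congr fun q => ?_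
  rw [← setLIntegral_const]
  exact setLIntegral_congr_fun (hm q) fun y hy => apply_eq_apply_mk_of_mem_image_mk_doubleCoset H K hF hy

/-- **The orbit sum over a finite set of classes**: if `F(π q.out) = 0` off a finite set `s` of
classes then `∫⁻ F dμ = Σ_{q ∈ s} F(π q.out) · μ(π(K q.out H))`. [cite: Laumon1995, Lemma (5.3.2) p. 136] -/
theorem lintegral_eq_sum_doubleCoset (hK : IsOpen (K : Set G)) (μ : Measure (G ⧸ H))
    {F : G ⧸ H → ℝ≥0∞} (hF : ∀ k : G, k ∈ K → ∀ y : G ⧸ H, F (k • y) = F y)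
    (s : Finset (DoubleCoset.Quotient (K : Set G) (H : Set G)))
    (hs : ∀ q, q ∉ s → F (q.out : G ⧸ H) = 0) :
    ∫⁻ y, F y ∂μ = ∑ q ∈ s,
      F (q.out : G ⧸ H) *
        μ ((QuotientGroup.mk : G → G ⧸ H) '' DoubleCoset.doubleCoset q.out (K : Set G) (H : Set G)) := by
  rw [lintegral_eq_tsum_doubleCoset H K hK μ hF, tsum_eq_sum]
  intro q hq
  rw [hs q hq, zero_mul]

/-- The `[0, ∞]`-norm of a `K`-invariant function unfolds:
`∫⁻ ‖F‖ₑ dμ = Σ'_{q} ‖F(π q.out)‖ₑ · μ(π(K q.out H))`. [cite: DeitmarEchterhoff2014, Thm. 1.5.3] -/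
theorem lintegral_enorm_eq_tsum_doubleCoset (hK : IsOpen (K : Set G)) (μ : Measure (G ⧸ H))
    {E : Type*} [NormedAddCommGroup E] {F : G ⧸ H → E}
    (hF : ∀ k : G, k ∈ K → ∀ y : G ⧸ H, F (k • y) = F y) :
    ∫⁻ y, ‖F y‖ₑ ∂μ = ∑' q : DoubleCoset.Quotient (K : Set G) (H : Set G),
      ‖F (q.out : G ⧸ H)‖ₑ *
        μ ((QuotientGroup.mk : G → G ⧸ H) '' DoubleCoset.doubleCoset q.out (K : Set G) (H : Set G)) :=
  lintegral_eq_tsum_doubleCoset H K hK μ (F := fun y => ‖F y‖ₑ) fun k hk y => by rw [hF k hk y]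

/-- **Integrability from finite support.** A `K`-invariant, a.e.-strongly measurable `F : G ⧸ H → E`
which vanishes off finitely many orbits, each of finite `μ`-measure, is `μ`-integrable. [cite: DeitmarEchterhoff2014, Thm. 1.5.3] -/
theorem integrable_of_finite_support (hK : IsOpen (K : Set G)) (μ : Measure (G ⧸ H))
    {E : Type*} [NormedAddCommGroup E] {F : G ⧸ H → E}
    (hF : ∀ k : G, k ∈ K → ∀ y : G ⧸ H, F (k • y) = F y) (hFm : AEStronglyMeasurable F μ)
    (s : Finset (DoubleCoset.Quotient (K : Set G) (H : Set G)))
    (hs : ∀ q, q ∉ s → F (q.out : G ⧸ H) = 0)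
    (hμ : ∀ q ∈ s, μ ((QuotientGroup.mk : G → G ⧸ H) ''
      DoubleCoset.doubleCoset q.out (K : Set G) (H : Set G)) < ∞) :
    Integrable F μ := by
  refine ⟨hFm, ?_⟩
  rw [hasFiniteIntegral_iff_enorm, lintegral_enorm_eq_tsum_doubleCoset H K hK μ hF, tsum_eq_sum (s := s)]
  · refine ENNReal.sum_lt_top.2 fun q hq => ?_
    exact ENNReal.mul_lt_top enorm_lt_top (hμ q hq)
  · intro q hq
    rw [hs q hq, enorm_zero, zero_mul]

/-- **The orbit sum (Bochner form, `HasSum`).** For an open subgroup `K`, any measure `μ` on `G ⧸ H`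
and an integrable `K`-invariant `F : G ⧸ H → E`:
`Σ_{q : K\G/H} μ(π(K q.out H)) • F(π q.out)` converges to `∫_{G ⧸ H} F dμ`.
[cite: Laumon1995, Lemma (5.3.2) p. 136] -/
theorem hasSum_integral_doubleCoset (hK : IsOpen (K : Set G)) (μ : Measure (G ⧸ H))
    {E : Type*} [NormedAddCommGroup E] [NormedSpace ℝ E] [CompleteSpace E] {F : G ⧸ H → E}
    (hF : ∀ k : G, k ∈ K → ∀ y : G ⧸ H, F (k • y) = F y) (hFi : Integrable F μ) :
    HasSum (fun q : DoubleCoset.Quotient (K : Set G) (H : Set G) =>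
      (μ ((QuotientGroup.mk : G → G ⧸ H) '' DoubleCoset.doubleCoset q.out (K : Set G) (H : Set G))).toReal •
        F (q.out : G ⧸ H)) (∫ y, F y ∂μ) := by
  haveI := countable_doubleCosetQuotient H K hK
  have hm : ∀ q : DoubleCoset.Quotient (K : Set G) (H : Set G), MeasurableSet
      ((QuotientGroup.mk : G → G ⧸ H) '' DoubleCoset.doubleCoset q.out (K : Set G) (H : Set G)) :=
    fun q => measurableSet_image_mk_doubleCoset H K hK _
  have h := hasSum_integral_iUnion hm (pairwise_disjoint_image_mk_doubleCoset H K) hFi.integrableOn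
  rw [iUnion_image_mk_doubleCoset H K, Measure.restrict_univ] at h
  refine h.congr_fun fun q => ?_   -- hmm, HasSum.congr
  rw [setIntegral_congr_fun (hm q)
      (fun y hy => apply_eq_apply_mk_of_mem_image_mk_doubleCoset H K hF hy),
    setIntegral_const, measureReal_def]

/-- **The orbit sum (Bochner form).** For an open subgroup `K`, any measure `μ` on `G ⧸ H` and an
integrable `K`-invariant `F : G ⧸ H → E`:
`∫_{G ⧸ H} F dμ = Σ'_{q : K\G/H} μ(π(K q.out H)) • F(π q.out)`. [cite: Laumon1995, Lemma (5.3.2) p. 136] -/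
theorem integral_eq_tsum_doubleCoset (hK : IsOpen (K : Set G)) (μ : Measure (G ⧸ H))
    {E : Type*} [NormedAddCommGroup E] [NormedSpace ℝ E] [CompleteSpace E] {F : G ⧸ H → E}
    (hF : ∀ k : G, k ∈ K → ∀ y : G ⧸ H, F (k • y) = F y) (hFi : Integrable F μ) :
    ∫ y, F y ∂μ = ∑' q : DoubleCoset.Quotient (K : Set G) (H : Set G),
      (μ ((QuotientGroup.mk : G → G ⧸ H) '' DoubleCoset.doubleCoset q.out (K : Set G) (H : Set G))).toReal •
        F (q.out : G ⧸ H) :=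
  (hasSum_integral_doubleCoset H K hK μ hF hFi).tsum_eq.symm

/-- **The orbit sum over a finite set of classes (Bochner form)**: if the integrable `K`-invariant
`F` vanishes at `π q.out` off a finite set `s` of classes, then
`∫ F dμ = Σ_{q ∈ s} μ(π(K q.out H)) • F(π q.out)`. [cite: Laumon1995, Lemma (5.3.2) p. 136] -/
theorem integral_eq_sum_doubleCoset (hK : IsOpen (K : Set G)) (μ : Measure (G ⧸ H))
    {E : Type*} [NormedAddCommGroup E] [NormedSpace ℝ E] [CompleteSpace E] {F : G ⧸ H → E}
    (hF : ∀ k : G, k ∈ K → ∀ y : G ⧸ H, F (k • y) = F y) (hFi : Integrable F μ)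
    (s : Finset (DoubleCoset.Quotient (K : Set G) (H : Set G)))
    (hs : ∀ q, q ∉ s → F (q.out : G ⧸ H) = 0) :
    ∫ y, F y ∂μ = ∑ q ∈ s,
      (μ ((QuotientGroup.mk : G → G ⧸ H) '' DoubleCoset.doubleCoset q.out (K : Set G) (H : Set G))).toReal •
        F (q.out : G ⧸ H) := by
  rw [integral_eq_tsum_doubleCoset H K hK μ hF hFi, tsum_eq_sum]
  intro q hq
  rw [hs q hq, smul_zero]

omit [SecondCountableTopology G] [MeasurableSpace (G ⧸ H)] [BorelSpace (G ⧸ H)] in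
/-- **Compact support ⇒ finitely many orbits.** If `F : G ⧸ H → α` has compact support then
`F(π q.out) ≠ 0` for only finitely many classes `q ∈ K \ G / H` (`K` open): the open orbits cover the
compact `tsupport F`, finitely many suffice, and an orbit carrying a non-zero value at its
representative is one of them (the orbits are disjoint). With `H = C_G(γ)` this is the finiteness of
the set of `γ`-fixed points on `G/K` modulo `C_G(γ)` meeting the support (Laumon (1996), Lemma (5.3.2):
«there are finitely many `G_γ(F)`-orbits …»). [cite: Laumon1995, Lemma (5.3.2) p. 136] -/
theorem finite_setOf_apply_out_ne_zero_of_hasCompactSupport (hK : IsOpen (K : Set G))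
    {α : Type*} [TopologicalSpace α] [Zero α] {F : G ⧸ H → α} (hFs : HasCompactSupport F) :
    {q : DoubleCoset.Quotient (K : Set G) (H : Set G) | F (q.out : G ⧸ H) ≠ 0}.Finite := by
  obtain ⟨t, ht⟩ := hFs.elim_finite_subcover
    (fun q : DoubleCoset.Quotient (K : Set G) (H : Set G) =>
      (QuotientGroup.mk : G → G ⧸ H) '' DoubleCoset.doubleCoset q.out (K : Set G) (H : Set G))
    (fun q => isOpen_image_mk_doubleCoset H K hK _)
    (by rw [iUnion_image_mk_doubleCoset H K]; exact Set.subset_univ _)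
  refine (t.finite_toSet).subset fun q hq => ?_
  have hmem : (q.out : G ⧸ H) ∈ tsupport F := subset_tsupport F hq
  obtain ⟨q', hq', hq'mem⟩ := Set.mem_iUnion₂.1 (ht hmem)
  have hqmem : (q.out : G ⧸ H) ∈ (QuotientGroup.mk : G → G ⧸ H) ''
      DoubleCoset.doubleCoset q.out (K : Set G) (H : Set G) :=
    ⟨q.out, DoubleCoset.mem_doubleCoset_self K H _, rfl⟩
  have hqq' : q = q' := by
    by_contra hne
    exact Set.disjoint_left.1 (pairwise_disjoint_image_mk_doubleCoset H K hne) hqmem hq'mem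
  rw [hqq']
  exact hq'

end OrbitSum

/-! ### §3 The masses of the orbits for a `G`-invariant measure -/

section Conj

variable {G : Type*} [Group G] (K : Subgroup G)

/-- Membership in the conjugate subgroup `x⁻¹ K x = K.comap (conj x)`: `g ∈ x⁻¹ K x ↔ x g x⁻¹ ∈ K`.
[cite: Laumon1995, Lemma (5.3.2) p. 136] -/
theorem mem_comap_conj_iff (x g : G) :
    g ∈ K.comap (MulAut.conj x).toMonoidHom ↔ x * g * x⁻¹ ∈ K := Iff.rfl

/-- The carrier of `x⁻¹ K x`: `{g | x g x⁻¹ ∈ K}`. [cite: Laumon1995, Lemma (5.3.2) p. 136] -/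
theorem coe_comap_conj (x : G) :
    (K.comap (MulAut.conj x).toMonoidHom : Set G) = {g | x * g * x⁻¹ ∈ K} := rfl

/-- The trace `H ∩ x⁻¹ K x` on a subgroup `H`, as a subset of `↥H`: `{c | x c x⁻¹ ∈ K}`. [cite: Laumon1995, Lemma (5.3.2) p. 136] -/
theorem preimage_val_coe_comap_conj (H : Subgroup G) (x : G) :
    (Subtype.val ⁻¹' (K.comap (MulAut.conj x).toMonoidHom : Set G) : Set H) =
      {c : H | x * (c : G) * x⁻¹ ∈ K} := rfl

/-- **`π(K x H) = x • π(x⁻¹ K x)`**: the image of the double coset `K x H` is the translate by `x` of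
the image of the conjugate subgroup `x⁻¹ K x` (`k x = x · (x⁻¹ k x)`). [cite: Laumon1995, Lemma (5.3.2) p. 136] -/
theorem image_mk_doubleCoset_eq_smul_image (H : Subgroup G) (x : G) :
    (QuotientGroup.mk : G → G ⧸ H) '' DoubleCoset.doubleCoset x (K : Set G) (H : Set G) =
      x • ((QuotientGroup.mk : G → G ⧸ H) '' (K.comap (MulAut.conj x).toMonoidHom : Set G)) := by
  ext y
  rw [mem_image_mk_doubleCoset_iff, Set.mem_smul_set]
  constructor
  · rintro ⟨k, hk, rfl⟩
    refine ⟨(x⁻¹ * k * x : G), ⟨x⁻¹ * k * x, ?_, rfl⟩, ?_⟩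
    · show x * (x⁻¹ * k * x) * x⁻¹ ∈ K
      simpa only [mul_assoc, mul_inv_cancel, mul_one, mul_inv_cancel_left] using hk
    · rw [MulAction.Quotient.smul_coe, MulAction.Quotient.smul_coe, smul_eq_mul, smul_eq_mul]
      congr 1
      simp only [← mul_assoc, mul_inv_cancel, one_mul]
  · rintro ⟨z, ⟨j, hj, rfl⟩, rfl⟩
    refine ⟨x * j * x⁻¹, hj, ?_⟩
    rw [MulAction.Quotient.smul_coe, MulAction.Quotient.smul_coe, smul_eq_mul, smul_eq_mul,
      inv_mul_cancel_right]

variable [TopologicalSpace G] [IsTopologicalGroup G]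

/-- `x⁻¹ K x` is open when `K` is. [cite: Laumon1995, Lemma (5.3.2) p. 136] -/
theorem isOpen_coe_comap_conj (hK : IsOpen (K : Set G)) (x : G) :
    IsOpen (K.comap (MulAut.conj x).toMonoidHom : Set G) := by
  rw [coe_comap_conj]
  exact hK.preimage ((continuous_const.mul continuous_id).mul continuous_const)

/-- `x⁻¹ K x` is compact when `K` is (it is the image of `K` under `g ↦ x⁻¹ g x`). [cite: Laumon1995, Lemma (5.3.2) p. 136] -/
theorem isCompact_coe_comap_conj (hKc : IsCompact (K : Set G)) (x : G) :
    IsCompact (K.comap (MulAut.conj x).toMonoidHom : Set G) := by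
  have h : (K.comap (MulAut.conj x).toMonoidHom : Set G) = (fun g => x⁻¹ * g * x) '' (K : Set G) := by
    ext g
    rw [coe_comap_conj, Set.mem_setOf_eq, Set.mem_image]
    constructor
    · intro hg
      exact ⟨x * g * x⁻¹, hg, by simp only [← mul_assoc, inv_mul_cancel, one_mul, inv_mul_cancel_right]⟩
    · rintro ⟨k, hk, rfl⟩
      simpa only [← mul_assoc, mul_inv_cancel, one_mul, mul_inv_cancel_right, SetLike.mem_coe] using hk
  rw [h]
  exact hKc.image ((continuous_const.mul continuous_id).mul continuous_const)

/-- A measure on `G` that is both left and right invariant gives `x⁻¹ K x` the measure of `K`.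
[cite: DeitmarEchterhoff2014, Thm. 1.5.3] -/
theorem measure_coe_comap_conj_eq [MeasurableSpace G] [BorelSpace G] (ν : Measure G)
    [ν.IsMulLeftInvariant] [ν.IsMulRightInvariant] (x : G) :
    ν (K.comap (MulAut.conj x).toMonoidHom : Set G) = ν K := by
  have h : (K.comap (MulAut.conj x).toMonoidHom : Set G) =
      (fun g => x * g) ⁻¹' ((fun g => g * x⁻¹) ⁻¹' (K : Set G)) := rfl
  rw [h, measure_preimage_mul, measure_preimage_mul_right]

end Conj

section Mass

variable {G : Type*} [Group G] [TopologicalSpace G] [IsTopologicalGroup G] [LocallyCompactSpace G]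
  [SecondCountableTopology G] [T2Space G] [MeasurableSpace G] [BorelSpace G]
  (H K : Subgroup G) [hH : IsClosed (H : Set G)]
  (ρ : Measure H) [ρ.IsMulLeftInvariant] [IsFiniteMeasureOnCompacts ρ]
  [MeasurableSpace (G ⧸ H)] [BorelSpace (G ⧸ H)]

omit [TopologicalSpace G] [IsTopologicalGroup G] [LocallyCompactSpace G] [SecondCountableTopology G]
  [T2Space G] [MeasurableSpace G] [BorelSpace G] hH [BorelSpace (G ⧸ H)] in
/-- **Orbit masses are conjugate-subgroup masses**: for a `G`-invariant measure `μ` on `G ⧸ H`,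
`μ(π(K x H)) = μ(π(x⁻¹ K x))` (`π(K x H) = x • π(x⁻¹ K x)` and `μ` is invariant). [cite: DeitmarEchterhoff2014, Thm. 1.5.3] -/
theorem measure_image_mk_doubleCoset_eq (μ : Measure (G ⧸ H)) [SMulInvariantMeasure G (G ⧸ H) μ]
    (x : G) :
    μ ((QuotientGroup.mk : G → G ⧸ H) '' DoubleCoset.doubleCoset x (K : Set G) (H : Set G)) =
      μ ((QuotientGroup.mk : G → G ⧸ H) '' (K.comap (MulAut.conj x).toMonoidHom : Set G)) := by
  rw [image_mk_doubleCoset_eq_smul_image K H x, measure_smul]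

omit [IsTopologicalGroup G] [LocallyCompactSpace G] [SecondCountableTopology G] [T2Space G]
  [BorelSpace G] hH [ρ.IsMulLeftInvariant] [IsFiniteMeasureOnCompacts ρ] [MeasurableSpace (G ⧸ H)]
  [BorelSpace (G ⧸ H)] in
/-- `0 < ρ(H ∩ x⁻¹ K x)` for `K` open (a neighbourhood of `1` in `H`). [cite: DeitmarEchterhoff2014, Thm. 1.5.3] -/
theorem measure_preimage_comap_conj_pos [IsTopologicalGroup G] [ρ.IsOpenPosMeasure]
    (hK : IsOpen (K : Set G)) (x : G) :
    0 < ρ (Subtype.val ⁻¹' (K.comap (MulAut.conj x).toMonoidHom : Set G)) :=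
  measure_preimage_subgroup_pos H ρ _ (isOpen_coe_comap_conj K hK x)

omit [LocallyCompactSpace G] [SecondCountableTopology G] [T2Space G] [BorelSpace G]
  [ρ.IsMulLeftInvariant] [MeasurableSpace (G ⧸ H)] [BorelSpace (G ⧸ H)] in
/-- `ρ(H ∩ x⁻¹ K x) < ∞` for `K` compact (`H` closed). [cite: DeitmarEchterhoff2014, Thm. 1.5.3] -/
theorem measure_preimage_comap_conj_lt_top (hKc : IsCompact (K : Set G)) (x : G) :
    ρ (Subtype.val ⁻¹' (K.comap (MulAut.conj x).toMonoidHom : Set G)) < ∞ :=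
  measure_preimage_subgroup_lt_top H ρ _ (isCompact_coe_comap_conj K hKc x)

/-- **The mass of an orbit, for any invariant measure**: for a `G`-invariant measure `μ` on `G ⧸ H`
finite on compact sets, a Haar measure `ν` on `G`, and a compact open subgroup `K`,
`μ(π(K x H)) = c_μ · ν(x⁻¹ K x) / ρ(H ∩ x⁻¹ K x)` with `c_μ = unfoldingConstant H ρ μ ν`
(`InvariantQuotientCompactOpenMass.measure_image_mk_eq_unfoldingConstant_mul_div` at the compact open
subgroup `x⁻¹ K x`). [cite: DeitmarEchterhoff2014, Thm. 1.5.3] -/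
theorem measure_image_mk_doubleCoset_eq_unfoldingConstant_mul_div [ρ.IsOpenPosMeasure] [SFinite ρ]
    (μ : Measure (G ⧸ H)) [IsFiniteMeasureOnCompacts μ] [SMulInvariantMeasure G (G ⧸ H) μ]
    (ν : Measure G) [IsHaarMeasure ν] (hK : IsOpen (K : Set G)) (hKc : IsCompact (K : Set G)) (x : G) :
    μ ((QuotientGroup.mk : G → G ⧸ H) '' DoubleCoset.doubleCoset x (K : Set G) (H : Set G)) =
      unfoldingConstant H ρ μ ν * ν (K.comap (MulAut.conj x).toMonoidHom : Set G) /
        ρ (Subtype.val ⁻¹' (K.comap (MulAut.conj x).toMonoidHom : Set G)) := by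
  rw [measure_image_mk_doubleCoset_eq H K μ x]
  exact measure_image_mk_eq_unfoldingConstant_mul_div H ρ ν μ _
    (isOpen_coe_comap_conj K hK x) (isCompact_coe_comap_conj K hKc x)

variable [ρ.IsOpenPosMeasure] [ρ.IsInvInvariant] [SFinite ρ]
  (ν : Measure G) [IsHaarMeasure ν] [ν.IsMulRightInvariant]

/-- **The mass of an orbit for the quotient measure `ν/ρ`**: for a two-sided Haar measure `ν` on `G`,
an inversion-invariant left Haar measure `ρ` on the closed subgroup `H` and a compact open subgroup
`K`: `(ν/ρ)(π(K x H)) = ν(K) / ρ(H ∩ x⁻¹ K x)` — the `K`-orbit of `xH` has mass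
`vol(K) / vol(H ∩ x⁻¹ K x)` (its stabiliser in `K` is `K ∩ x H x⁻¹ ≅ H ∩ x⁻¹ K x`). With `ν(K) = 1`
this is the weight `vol(H ∩ x⁻¹ K x)⁻¹` of Laumon (1996), Lemma (5.3.2). [cite: Laumon1995, Lemma (5.3.2) p. 136] -/
theorem quotientMeasure_image_mk_doubleCoset_eq_div (hK : IsOpen (K : Set G))
    (hKc : IsCompact (K : Set G)) (x : G) :
    quotientMeasure H ρ hH ν
        ((QuotientGroup.mk : G → G ⧸ H) '' DoubleCoset.doubleCoset x (K : Set G) (H : Set G)) =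
      ν K / ρ (Subtype.val ⁻¹' (K.comap (MulAut.conj x).toMonoidHom : Set G)) := by
  rw [measure_image_mk_doubleCoset_eq H K (quotientMeasure H ρ hH ν) x,
    quotientMeasure_image_mk_eq_div H ρ ν _ (isOpen_coe_comap_conj K hK x)
      (isCompact_coe_comap_conj K hKc x),
    measure_coe_comap_conj_eq K ν x]

/-- With `ν(K) = 1`: `(ν/ρ)(π(K x H)) = ρ(H ∩ x⁻¹ K x)⁻¹`. [cite: Laumon1995, Lemma (5.3.2) p. 136] -/
theorem quotientMeasure_image_mk_doubleCoset_eq_inv (hK : IsOpen (K : Set G))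
    (hKc : IsCompact (K : Set G)) (hν : ν K = 1) (x : G) :
    quotientMeasure H ρ hH ν
        ((QuotientGroup.mk : G → G ⧸ H) '' DoubleCoset.doubleCoset x (K : Set G) (H : Set G)) =
      (ρ (Subtype.val ⁻¹' (K.comap (MulAut.conj x).toMonoidHom : Set G)))⁻¹ := by
  rw [quotientMeasure_image_mk_doubleCoset_eq_div H K ρ ν hK hKc x, hν, one_div]

/-- The orbit masses of `ν/ρ` are positive and finite: `0 < ν(K) / ρ(H ∩ x⁻¹ K x) < ∞`. [cite: DeitmarEchterhoff2014, Thm. 1.5.3] -/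
theorem quotientMeasure_image_mk_doubleCoset_pos_lt_top (hK : IsOpen (K : Set G))
    (hKc : IsCompact (K : Set G)) (x : G) :
    0 < quotientMeasure H ρ hH ν
        ((QuotientGroup.mk : G → G ⧸ H) '' DoubleCoset.doubleCoset x (K : Set G) (H : Set G)) ∧
      quotientMeasure H ρ hH ν
        ((QuotientGroup.mk : G → G ⧸ H) '' DoubleCoset.doubleCoset x (K : Set G) (H : Set G)) < ∞ := by
  rw [quotientMeasure_image_mk_doubleCoset_eq_div H K ρ ν hK hKc x]
  refine ⟨ENNReal.div_pos (hK.measure_pos ν ⟨1, K.one_mem⟩).ne'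
      (measure_preimage_comap_conj_lt_top H K ρ hKc x).ne, ?_⟩
  exact ENNReal.div_lt_top hKc.measure_lt_top.ne (measure_preimage_comap_conj_pos H K ρ hK x).ne'

/-! ### §4 The assembled unfolding against the quotient measure -/

/-- **Unfolding of `ν/ρ` over `K \ G / H`.** For `G` locally compact second countable Hausdorff,
`H ≤ G` closed with an inversion-invariant left Haar measure `ρ`, `ν` a two-sided Haar measure on `G`,
`K ≤ G` a compact open subgroup and `F : G ⧸ H → [0, ∞]` invariant under `K`:
`∫⁻_{G ⧸ H} F d(ν/ρ) = Σ'_{q : K\G/H} F(π q.out) · ν(K) / ρ(H ∩ q.out⁻¹ K q.out)`.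
[cite: Laumon1995, Lemma (5.3.2) p. 136] -/
theorem lintegral_quotientMeasure_eq_tsum_doubleCoset (hK : IsOpen (K : Set G))
    (hKc : IsCompact (K : Set G)) {F : G ⧸ H → ℝ≥0∞}
    (hF : ∀ k : G, k ∈ K → ∀ y : G ⧸ H, F (k • y) = F y) :
    ∫⁻ y, F y ∂quotientMeasure H ρ hH ν =
      ∑' q : DoubleCoset.Quotient (K : Set G) (H : Set G),
        F (q.out : G ⧸ H) *
          (ν K / ρ (Subtype.val ⁻¹' (K.comap (MulAut.conj q.out).toMonoidHom : Set G))) := by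
  rw [lintegral_eq_tsum_doubleCoset H K hK _ hF]
  exact tsum_congr fun q => by rw [quotientMeasure_image_mk_doubleCoset_eq_div H K ρ ν hK hKc]

/-- **Unfolding of `ν/ρ` over `K \ G / H`, Bochner form**: for an integrable `K`-invariant
`F : G ⧸ H → E`,
`∫_{G ⧸ H} F d(ν/ρ) = Σ'_{q : K\G/H} (ν(K) / ρ(H ∩ q.out⁻¹ K q.out)) • F(π q.out)`.
[cite: Laumon1995, Lemma (5.3.2) p. 136] -/
theorem integral_quotientMeasure_eq_tsum_doubleCoset (hK : IsOpen (K : Set G))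
    (hKc : IsCompact (K : Set G)) {E : Type*} [NormedAddCommGroup E] [NormedSpace ℝ E]
    [CompleteSpace E] {F : G ⧸ H → E} (hF : ∀ k : G, k ∈ K → ∀ y : G ⧸ H, F (k • y) = F y)
    (hFi : Integrable F (quotientMeasure H ρ hH ν)) :
    ∫ y, F y ∂quotientMeasure H ρ hH ν =
      ∑' q : DoubleCoset.Quotient (K : Set G) (H : Set G),
        (ν K / ρ (Subtype.val ⁻¹' (K.comap (MulAut.conj q.out).toMonoidHom : Set G))).toReal •
          F (q.out : G ⧸ H) := by
  rw [integral_eq_tsum_doubleCoset H K hK _ hF hFi]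
  exact tsum_congr fun q => by rw [quotientMeasure_image_mk_doubleCoset_eq_div H K ρ ν hK hKc]

omit [ρ.IsInvInvariant] [ν.IsMulRightInvariant] in
/-- **Unfolding of any invariant `μ` over `K \ G / H`**: for a `G`-invariant Borel measure `μ` on
`G ⧸ H` finite on compact sets, with `c_μ = unfoldingConstant H ρ μ ν`:
`∫⁻_{G ⧸ H} F dμ = Σ'_{q} F(π q.out) · c_μ ν(q.out⁻¹ K q.out) / ρ(H ∩ q.out⁻¹ K q.out)`.
[cite: DeitmarEchterhoff2014, Thm. 1.5.3] -/
theorem lintegral_eq_tsum_doubleCoset_unfoldingConstant (μ : Measure (G ⧸ H))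
    [IsFiniteMeasureOnCompacts μ] [SMulInvariantMeasure G (G ⧸ H) μ] (hK : IsOpen (K : Set G))
    (hKc : IsCompact (K : Set G)) {F : G ⧸ H → ℝ≥0∞}
    (hF : ∀ k : G, k ∈ K → ∀ y : G ⧸ H, F (k • y) = F y) :
    ∫⁻ y, F y ∂μ =
      ∑' q : DoubleCoset.Quotient (K : Set G) (H : Set G),
        F (q.out : G ⧸ H) *
          (unfoldingConstant H ρ μ ν * ν (K.comap (MulAut.conj q.out).toMonoidHom : Set G) /
            ρ (Subtype.val ⁻¹' (K.comap (MulAut.conj q.out).toMonoidHom : Set G))) := by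
  rw [lintegral_eq_tsum_doubleCoset H K hK _ hF]
  exact tsum_congr fun q => by
    rw [measure_image_mk_doubleCoset_eq_unfoldingConstant_mul_div H K ρ μ ν hK hKc]

end Mass

end Literature.MeasureTheory.Group
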